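import Summits.AtomisticToContinuum.HydrodynamicLimit.Theorems.OneFlightGossipEngineClampedCurrentsDockHeartWindow
import HarnessLib

/-!
# The per-window estimate of the heart with an additive cubic slack (line `Sketch`, crux `ClampedTransferDock`, stmt-17615)

Helper file (`--supports stmt-AtomisticToContinuum-17615`, registered sub-goal `window_bookkeeping_rate`) proving the registered
stub `stub_windowEstimateRate : WindowEstimateRate` (consumed by `stub_windowClauseRate`) of the lead's skeleton `Cruxes/ClampedTransferDock/Lines/Sketch.lean`: the RATE twin of the sibling
crux's landed `ClampedCurrentsDockHeart.window_estimate` (`Theorems/OneFlightGossipEngineClampedCurrentsDockHeartWindow.lean`, lead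
14680-c2). The line re-threads the cubic (heat-flux remainder) channel of Yau's one-window ledger at a rate: its per-window bound is no
longer `w(N+1)ε′/10` but `w(N+1)ε′/10 + Q` with `Q = w(N+1)A e^{-cK₁} + w B K₁ H_N(s)` (band paid by the running entropy, top by the tail
rate). Since the heart consumes the cubic channel only through that one real number (`window_bookkeeping`), the twin is the same proof
with `Q ≥ 0` carried additively: `−E[entropy production of the window] ≤ (5/β) w H_N(s) + w(N+1)ε′ + Q + w(N+1)Cst(s)`. No new
mathematics; statements and proofs adapted verbatim from the two sibling files (attributed). prover-line-stmt-AtomisticToContinuum-17615-0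
(lead, cycle 1).
-/

noncomputable section

namespace Summit.AtomisticToContinuum.HydrodynamicLimit.Theorems.ClampedTransferDockRate

open scoped BigOperators ENNReal Classical Interval
open MeasureTheory Filter Set Topology InformationTheory
open Literature.MathematicalPhysics.KineticTheory Literature.Analysis.FluidPDE Literature.Analysis.FunctionSpaces
open Summit.AtomisticToContinuum.HydrodynamicLimit.Theorems
open Summit.AtomisticToContinuum.HydrodynamicLimit.Theorems.ClampedCurrentsDockHeart

/-- **One window in expectation (pure bookkeeping), with an additive cubic slack `Q`** (rate twin of
`ClampedCurrentsDockHeart.window_bookkeeping`, adapted from `Theorems/OneFlightGossipEngineClampedCurrentsDockHeartChannels.lean`). If the entropy production `−X` of the window is dominated on the good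
set by `kin + hiT + J + K₁·tail + 2C_f w·cub + K_c` with the channel bounds of the heart (kinetic and collisional rows through
the entropy inequality at tilt `β`, cubic channel `w(N+1)ε′/10`, activity tails `(N+1)ε₃`, third moments `w(N+1)(M³+1)`), the
accuracies `ε₁ = βε′/10`, `ε₃ = ε′/(40(L+1))` and the window smallness `C_f w · 40(2M³ + 6 + V) ≤ ε′ ≤ 1`, then
`−E[X] ≤ (5/β) w H + w(N+1)ε′ + w(N+1)Cst`. [cite: Yau1991, §3] -/
theorem window_bookkeeping_rate :
    ∀ {Ω : Type*} [MeasurableSpace Ω] {P : MeasureTheory.Measure Ω} [MeasureTheory.IsProbabilityMeasure P] {good : Set Ω},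
    (∀ᵐ z ∂P, z ∈ good) → ∀ {X kin hiT J tail cub : Ω → ℝ} {w β Hs ε' ε₁ ε₃ L Cf M V Nr Cst Q : ℝ},
    0 < w → 0 < β → 0 < ε' → ε' ≤ 1 → 0 ≤ L → 0 ≤ Cf → 0 ≤ M → 0 ≤ V → 0 < Nr → ε₁ = β * ε' / 10 →
    ε₃ = ε' / (40 * (L + 1)) → Cf * w * (40 * (2 * M ^ 3 + 6 + V)) ≤ ε' → MeasureTheory.Integrable X P →
    (∀ z ∈ good, -X z ≤ kin z + hiT z + J z + (2 * L * w + 2 * Cf * w ^ 2) * tail z + (2 * Cf * w) * cub z +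
      (w * Nr * Cst + 3 * Cf * w ^ 2 * Nr + 2 * Cf * w ^ 2 * (Nr * V))) →
    (MeasureTheory.Integrable kin P ∧ ∫ z, kin z ∂P ≤ w * (β⁻¹ * (Hs + ε₁ * Nr))) →
    (MeasureTheory.Integrable hiT P ∧ ∫ z, hiT z ∂P ≤ w * Nr * (ε' / 10) + Q) →
    (MeasureTheory.Integrable J P ∧ ∫ z, J z ∂P ≤ 4 * (w * (β⁻¹ * (Hs + ε₁ / 4 * Nr)))) →
    (MeasureTheory.Integrable tail P ∧ ∫ z, tail z ∂P ≤ Nr * ε₃) →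
    (MeasureTheory.Integrable cub P ∧ ∫ z, cub z ∂P ≤ w * Nr * (M ^ 3 + 1)) →
    -(∫ z, X z ∂P) ≤ 5 / β * w * Hs + w * Nr * ε' + Q + w * Nr * Cst := by
  intro Ω _ P _ good hgood X kin hiT J tail cub w β Hs ε' ε₁ ε₃ L Cf M V Nr Cst Q hw hβ hε hε1 hL hCf hM hV hNr hε₁ hε₃ hsmall hX hdom hkin hhiT hJ htail hcub
  set Kc : ℝ := w * Nr * Cst + 3 * Cf * w ^ 2 * Nr + 2 * Cf * w ^ 2 * (Nr * V) with hKc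
  set Gf : Ω → ℝ := fun z => kin z + hiT z + J z + (2 * L * w + 2 * Cf * w ^ 2) * tail z + (2 * Cf * w) * cub z + Kc with hGf
  have I2 : Integrable (fun z => kin z + hiT z) P := hkin.1.add hhiT.1
  have I3 : Integrable (fun z => kin z + hiT z + J z) P := I2.add hJ.1
  have J4 : Integrable (fun z => (2 * L * w + 2 * Cf * w ^ 2) * tail z) P := htail.1.const_mul _
  have I4 : Integrable (fun z => kin z + hiT z + J z + (2 * L * w + 2 * Cf * w ^ 2) * tail z) P := I3.add J4
  have J5 : Integrable (fun z => (2 * Cf * w) * cub z) P := hcub.1.const_mul _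
  have I5 : Integrable (fun z => kin z + hiT z + J z + (2 * L * w + 2 * Cf * w ^ 2) * tail z + (2 * Cf * w) * cub z) P :=
    I4.add J5
  have hGfI : Integrable Gf P := I5.add (integrable_const _)
  have hGfint : ∫ z, Gf z ∂P = (∫ z, kin z ∂P) + (∫ z, hiT z ∂P) + (∫ z, J z ∂P) +
      (2 * L * w + 2 * Cf * w ^ 2) * (∫ z, tail z ∂P) + (2 * Cf * w) * (∫ z, cub z ∂P) + Kc := by
    simp only [hGf]
    rw [integral_add I5 (integrable_const _), integral_add I4 J5, integral_add I3 J4, integral_add I2 hJ.1,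
      integral_add hkin.1 hhiT.1, integral_const_mul, integral_const_mul, integral_const, probReal_univ, one_smul]
  have hmono : ∫ z, -X z ∂P ≤ ∫ z, Gf z ∂P :=
    integral_mono_ae hX.neg hGfI (hgood.mono fun z hz => by simpa only [hGf, hKc] using hdom z hz)
  rw [integral_neg, hGfint] at hmono
  -- the accuracies
  have hX1 : Cf * w ≤ 1 := by
    have hQ : (40 : ℝ) ≤ 40 * (2 * M ^ 3 + 6 + V) := by nlinarith [pow_nonneg hM 3]
    nlinarith [mul_nonneg hCf hw.le]
  have t1 : w * (β⁻¹ * (Hs + ε₁ * Nr)) + 4 * (w * (β⁻¹ * (Hs + ε₁ / 4 * Nr))) = 5 / β * w * Hs + w * Nr * (ε' / 5) := by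
    rw [hε₁]; field_simp; ring
  have t3 : (2 * L * w + 2 * Cf * w ^ 2) * (Nr * ε₃) ≤ w * Nr * (ε' / 20) := by
    have h : (2 * L + 2 * (Cf * w)) * ε₃ ≤ ε' / 20 := by
      rw [hε₃, mul_div_assoc', div_le_div_iff₀ (by positivity) (by norm_num : (0 : ℝ) < 20)]
      nlinarith [mul_nonneg hCf hw.le, hε.le]
    have e : (2 * L * w + 2 * Cf * w ^ 2) * (Nr * ε₃) = w * Nr * ((2 * L + 2 * (Cf * w)) * ε₃) := by ring
    rw [e]
    exact mul_le_mul_of_nonneg_left h (by positivity)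
  have t4 : (2 * Cf * w) * (w * Nr * (M ^ 3 + 1)) + (3 * Cf * w ^ 2 * Nr + 2 * Cf * w ^ 2 * (Nr * V)) ≤
      w * Nr * (ε' / 20) := by
    have h : Cf * w * (2 * (M ^ 3 + 1) + 3 + 2 * V) ≤ ε' / 20 := by
      have : 2 * (M ^ 3 + 1) + 3 + 2 * V ≤ 2 * (2 * M ^ 3 + 6 + V) := by nlinarith [pow_nonneg hM 3]
      nlinarith [mul_nonneg hCf hw.le]
    have e : (2 * Cf * w) * (w * Nr * (M ^ 3 + 1)) + (3 * Cf * w ^ 2 * Nr + 2 * Cf * w ^ 2 * (Nr * V)) =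
        w * Nr * (Cf * w * (2 * (M ^ 3 + 1) + 3 + 2 * V)) := by ring
    rw [e]
    exact mul_le_mul_of_nonneg_left h (by positivity)
  have hwN : 0 ≤ w * Nr * ε' := by positivity
  have m4 := mul_le_mul_of_nonneg_left htail.2 (by positivity : (0 : ℝ) ≤ 2 * L * w + 2 * Cf * w ^ 2)
  have m5 := mul_le_mul_of_nonneg_left hcub.2 (by positivity : (0 : ℝ) ≤ 2 * Cf * w)
  simp only [hKc] at hmono
  linarith [hmono, hkin.2, hhiT.2, hJ.2, m4, m5, t1, t3, t4, hwN]

/-- registered stub signature `stub_windowEstimateRate` of line Sketch, crux ClampedTransferDock (stmt-17615): the heart's per-window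
estimate with an additive cubic slack `Q ≥ 0` — the statement of `ClampedCurrentsDockHeart.window_estimate` with `hQs` bounded by
`w(N+1)ε′/10 + Q` and `+ Q` in the conclusion (power literals written `^ (n : ℕ)` so that the proposition elaborates at default cost;
the terms are identical) — route-internal plumbing, not a cited fact -/
def WindowEstimateRate : Prop :=
  ∀ {σ T η₁ τ t s w V L Cfz CG β ε' ε₁ ε₃ M₃ Q : ℝ} {N : ℕ}
      (Φ : HardSphereFlow (Torus.geometry (Fin 3)) (hsDiameter σ N) (N + 1))
      {ρ θ : ℝ → T3 → ℝ} {u : ℝ → T3 → V3} {F Rf : ℝ → ℝ} {G : ℝ → T3 × ℝ → ℝ} {a₀ θ₀ : T3 → ℝ} {u₀ : T3 → V3}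
      (ha₀ : Continuous a₀) (hθ₀ : Continuous θ₀) (hu₀ : Continuous u₀) (ha₀0 : ∀ x, 0 < a₀ x) (hθ₀0 : ∀ x, 0 < θ₀ x)
      (hEul : IsHardSphereEulerSolution σ T ρ u θ) (hσ : 0 < σ) (hσ2 : σ < 1 / 2) (hη₁ : 0 < η₁)
      (hF : AnalyticOnNhd ℝ F (Ioo (-η₁) η₁)) (hZF : ∀ η ∈ Ioo 0 η₁, hsCompressibility η = 1 + η * deriv F η)
      (hRfF : ∀ η ∈ Ioo 0 η₁, 0 < Rf η ∧ DifferentiableAt ℝ (fun x => Real.log (Rf x)) η ∧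
        deriv (fun x => Real.log (Rf x)) η = 2 * deriv F η + η * deriv (deriv F) η)
      (hpackF : ∀ t' ∈ Ico 0 T, ∀ x, ρ t' x * σ ^ (3 : ℕ) ∈ Ioo 0 η₁)
      (ha : Torus.IsSmoothSpaceTimeOn (Ico 0 T) fun t' x => ρ t' x * Rf (σ ^ (3 : ℕ) * ρ t' x))
      (ha0 : ∀ t' ∈ Ico 0 T, ∀ x, 0 < ρ t' x * Rf (σ ^ (3 : ℕ) * ρ t' x))
      (ht : t ∈ Ioo 0 T) (hs0 : 0 ≤ s) (hw : 0 < w) (hsw : s + w ≤ t) (hτ : 0 < τ)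
      (hw_def : w = τ * ((N : ℝ) + 1) ^ (-(1 / 3 : ℝ)))
      (hV0 : 0 ≤ V) (hL0 : 0 ≤ L) (hCfz0 : 0 ≤ Cfz)
      (hLipm : ∀ (k : Fin 3) (x y : T3), |u s x k / θ s x - u s y k / θ s y| ≤ L * Torus.euclidDist x y)
      (hLipe : ∀ x y : T3, |(-(θ s x)⁻¹) - (-(θ s y)⁻¹)| ≤ L * Torus.euclidDist x y)
      (hGs : Continuous (G s)) (hCG : ∀ y : T3 × ℝ, 0 ≤ y.2 → |G s y| ≤ CG)
      (HFZ : ∀ s₁ ∈ Icc 0 t, ∀ s₂ ∈ Icc 0 t, ∀ (x : T3) (v : V3),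
        (let fast := fun (s : ℝ) (y : T3 × V3) =>
           (θ s y.1)⁻¹ * ∑ j : Fin 3, ∑ k : Fin 3,
               ((y.2 - u s y.1) j * (y.2 - u s y.1) k - (if j = k then ‖y.2 - u s y.1‖ ^ (2 : ℕ) / 3 else 0)) *
                 Torus.partialDeriv k (fun x => u s x j) y.1 +
             (‖y.2 - u s y.1‖ ^ (2 : ℕ) - 5 * θ s y.1) * (∑ k : Fin 3, (y.2 - u s y.1) k * Torus.partialDeriv k (θ s) y.1) /
               (2 * (θ s y.1) ^ (2 : ℕ))
         let P := fun (s : ℝ) (y : T3 × V3) =>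
           (∑ k : Fin 3, Torus.partialDeriv k (fun x => u s x k / θ s x) y.1) *
             (θ s y.1 * (ρ s y.1 * σ ^ (3 : ℕ)) * deriv hsCompressibility (ρ s y.1 * σ ^ (3 : ℕ)) +
               (1 / 3) * (hsCompressibility (ρ s y.1 * σ ^ (3 : ℕ)) - 1) * ‖y.2 - u s y.1‖ ^ (2 : ℕ)) +
           ((∑ k : Fin 3, u s y.1 k * Torus.partialDeriv k (θ s) y.1) / (θ s y.1) ^ (2 : ℕ)) *
             (θ s y.1 * (ρ s y.1 * σ ^ (3 : ℕ)) * deriv hsCompressibility (ρ s y.1 * σ ^ (3 : ℕ)) +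
               (1 / 3) * (hsCompressibility (ρ s y.1 * σ ^ (3 : ℕ)) - 1) * ‖y.2 - u s y.1‖ ^ (2 : ℕ)) +
           (hsCompressibility (ρ s y.1 * σ ^ (3 : ℕ)) - 1) *
             (∑ k : Fin 3, (y.2 - u s y.1) k * Torus.partialDeriv k (θ s) y.1) / θ s y.1
         |fast s₁ (x, v) - fast s₂ (x, v)| ≤ Cfz * |s₁ - s₂| * (1 + ‖v‖ ^ (3 : ℕ)) ∧
         |P s₁ (x, v) - P s₂ (x, v)| ≤ Cfz * |s₁ - s₂| * (1 + ‖v‖ ^ (2 : ℕ)) ∧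
         (∀ (k : Fin 3) (x' : T3),
            |(u s₁ x k / θ s₁ x - u s₁ x' k / θ s₁ x') - (u s₂ x k / θ s₂ x - u s₂ x' k / θ s₂ x')| ≤
              Cfz * |s₁ - s₂| * Torus.euclidDist x x') ∧
         (∀ x' : T3, |((θ s₁ x)⁻¹ - (θ s₁ x')⁻¹) - ((θ s₂ x)⁻¹ - (θ s₂ x')⁻¹)| ≤ Cfz * |s₁ - s₂| * Torus.euclidDist x x') ∧
         (∀ (k : Fin 3) (x' : T3), |u s₁ x k / θ s₁ x - u s₁ x' k / θ s₁ x'| ≤ Cfz * Torus.euclidDist x x') ∧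
         (∀ x' : T3, |(-(θ s₁ x)⁻¹) - (-(θ s₁ x')⁻¹)| ≤ Cfz * Torus.euclidDist x x')))
      (hβ : 0 < β) (hε : 0 < ε') (hε1 : ε' ≤ 1) (hε₁ : ε₁ = β * ε' / 10) (hε₃ : ε₃ = ε' / (40 * (L + 1))) (hQ0 : 0 ≤ Q)
      (hsmall : Cfz * w * (40 * (2 * (max M₃ 0) ^ (3 : ℕ) + 6 + V)) ≤ ε')
      -- the per-window inputs
      (hKs : ∫⁻ z, ENNReal.ofReal (Real.exp ((-β) * ∑ i : Fin (N + 1), w⁻¹ * ∫ r in (0 : ℝ)..w,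
          ((θ s (Φ.flow r z i).1)⁻¹ * ∑ j : Fin 3, ∑ k : Fin 3,
              (((Φ.flow r z i).2 - u s (Φ.flow r z i).1) j * ((Φ.flow r z i).2 - u s (Φ.flow r z i).1) k - (if j = k then ‖(Φ.flow r z i).2 - u s (Φ.flow r z i).1‖ ^ (2 : ℕ) / 3 else 0)) *
                Torus.partialDeriv k (fun x => u s x j) (Φ.flow r z i).1 +
            (∑ k : Fin 3, Torus.partialDeriv k (θ s) (Φ.flow r z i).1 / (2 * (θ s (Φ.flow r z i).1) ^ (2 : ℕ)) * ((Φ.flow r z i).2 - u s (Φ.flow r z i).1) k) *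
              G s ((Φ.flow r z i).1, ‖(Φ.flow r z i).2 - u s (Φ.flow r z i).1‖ ^ (2 : ℕ))))) ∂(localGibbsLaw σ (fun x => ρ s x * Rf (σ ^ (3 : ℕ) * ρ s x)) (u s) (θ s) N Φ) ≤
        ENNReal.ofReal (Real.exp (ε₁ * ((N : ℝ) + 1))))
      (hCm : ∀ k : Fin 3, ∫⁻ z, ENNReal.ofReal (Real.exp ((-β) * (w⁻¹ * (Φ.collisionSum (Ioc 0 w) (fun c =>
            (if σ / τ * Φ.collisionSum (Ioc 0 w) (fun c' => if c'.fst = c.fst then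
                ‖c'.postVel.1 - c'.preVel.1‖ + |‖c'.postVel.1‖ ^ (2 : ℕ) - ‖c'.preVel.1‖ ^ (2 : ℕ)| / 2 else 0) z ≤ V
              then (1 : ℝ) else 0) *
            (if σ / τ * Φ.collisionSum (Ioc 0 w) (fun c' => if c'.fst = c.snd then
                ‖c'.postVel.1 - c'.preVel.1‖ + |‖c'.postVel.1‖ ^ (2 : ℕ) - ‖c'.preVel.1‖ ^ (2 : ℕ)| / 2 else 0) z ≤ V
              then (1 : ℝ) else 0) *
            ((u s c.fstPos k / θ s c.fstPos - u s c.sndPos k / θ s c.sndPos) * (c.postVel.1 k - c.preVel.1 k)) / 2)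
            z) -
          w⁻¹ * ((∫ r in (0 : ℝ)..w, ∑ i : Fin (N + 1), (Torus.partialDeriv k (fun x => u s x k / θ s x) (Φ.flow r z i).1 *
              (θ s (Φ.flow r z i).1 * (ρ s (Φ.flow r z i).1 * σ ^ (3 : ℕ)) * deriv hsCompressibility (ρ s (Φ.flow r z i).1 * σ ^ (3 : ℕ)) +
                (1 / 3) * (hsCompressibility (ρ s (Φ.flow r z i).1 * σ ^ (3 : ℕ)) - 1) * ‖(Φ.flow r z i).2 - u s (Φ.flow r z i).1‖ ^ (2 : ℕ)))) - (w * ((N : ℝ) + 1) * ∫ x, ρ s x * Torus.partialDeriv k (fun x => u s x k / θ s x) x *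
            (θ s x * (ρ s x * σ ^ (3 : ℕ)) * deriv hsCompressibility (ρ s x * σ ^ (3 : ℕ)))))))) ∂(localGibbsLaw σ (fun x => ρ s x * Rf (σ ^ (3 : ℕ) * ρ s x)) (u s) (θ s) N Φ) ≤
        ENNReal.ofReal (Real.exp (ε₁ / 4 * ((N : ℝ) + 1))))
      (hCe : ∫⁻ z, ENNReal.ofReal (Real.exp ((-β) * (w⁻¹ * (Φ.collisionSum (Ioc 0 w) (fun c =>
            (if σ / τ * Φ.collisionSum (Ioc 0 w) (fun c' => if c'.fst = c.fst then
                ‖c'.postVel.1 - c'.preVel.1‖ + |‖c'.postVel.1‖ ^ (2 : ℕ) - ‖c'.preVel.1‖ ^ (2 : ℕ)| / 2 else 0) z ≤ V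
              then (1 : ℝ) else 0) *
            (if σ / τ * Φ.collisionSum (Ioc 0 w) (fun c' => if c'.fst = c.snd then
                ‖c'.postVel.1 - c'.preVel.1‖ + |‖c'.postVel.1‖ ^ (2 : ℕ) - ‖c'.preVel.1‖ ^ (2 : ℕ)| / 2 else 0) z ≤ V
              then (1 : ℝ) else 0) *
            ((-(θ s c.fstPos)⁻¹ - -(θ s c.sndPos)⁻¹) * ((‖c.postVel.1‖ ^ (2 : ℕ) - ‖c.preVel.1‖ ^ (2 : ℕ)) / 2)) / 2) z) -
          w⁻¹ * ((∫ r in (0 : ℝ)..w, ∑ i : Fin (N + 1), ((∑ l : Fin 3, u s (Φ.flow r z i).1 l * Torus.partialDeriv l (fun x => -(θ s x)⁻¹) (Φ.flow r z i).1) *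
              (θ s (Φ.flow r z i).1 * (ρ s (Φ.flow r z i).1 * σ ^ (3 : ℕ)) * deriv hsCompressibility (ρ s (Φ.flow r z i).1 * σ ^ (3 : ℕ)) +
                (1 / 3) * (hsCompressibility (ρ s (Φ.flow r z i).1 * σ ^ (3 : ℕ)) - 1) * ‖(Φ.flow r z i).2 - u s (Φ.flow r z i).1‖ ^ (2 : ℕ)) +
            θ s (Φ.flow r z i).1 * (hsCompressibility (ρ s (Φ.flow r z i).1 * σ ^ (3 : ℕ)) - 1) *
              (∑ l : Fin 3, Torus.partialDeriv l (fun x => -(θ s x)⁻¹) (Φ.flow r z i).1 * ((Φ.flow r z i).2 - u s (Φ.flow r z i).1) l))) - (w * ((N : ℝ) + 1) * ∫ x, ρ s x * (∑ l : Fin 3, u s x l * Torus.partialDeriv l (fun x => -(θ s x)⁻¹) x) *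
            (θ s x * (ρ s x * σ ^ (3 : ℕ)) * deriv hsCompressibility (ρ s x * σ ^ (3 : ℕ)))))))) ∂(localGibbsLaw σ (fun x => ρ s x * Rf (σ ^ (3 : ℕ) * ρ s x)) (u s) (θ s) N Φ) ≤
        ENNReal.ofReal (Real.exp (ε₁ / 4 * ((N : ℝ) + 1))))
      (hTs : ∫⁻ z, ENNReal.ofReal (((N : ℝ) + 1)⁻¹ * ∑ i : Fin (N + 1),
          Set.indicator {y : ℝ | V < y} (fun y => y) (σ / τ * Φ.collisionSum (Ioc s (s + w)) (fun c => if c.fst = i then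
          ‖c.postVel.1 - c.preVel.1‖ + |‖c.postVel.1‖ ^ (2 : ℕ) - ‖c.preVel.1‖ ^ (2 : ℕ)| / 2 else 0) z)) ∂(localGibbsLaw σ a₀ u₀ θ₀ N Φ) ≤ ENNReal.ofReal ε₃)
      (hQs : ∫⁻ z, ENNReal.ofReal |∫ r in s..(s + w), ∑ i : Fin (N + 1), ((∑ k : Fin 3, Torus.partialDeriv k (θ s) (Φ.flow r z i).1 / (2 * (θ s (Φ.flow r z i).1) ^ (2 : ℕ)) * ((Φ.flow r z i).2 - u s (Φ.flow r z i).1) k) *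
            (‖(Φ.flow r z i).2 - u s (Φ.flow r z i).1‖ ^ (2 : ℕ) - 5 * θ s (Φ.flow r z i).1 - G s ((Φ.flow r z i).1, ‖(Φ.flow r z i).2 - u s (Φ.flow r z i).1‖ ^ (2 : ℕ))))| ∂(localGibbsLaw σ a₀ u₀ θ₀ N Φ) ≤
        ENNReal.ofReal (w * ((N : ℝ) + 1) * (ε' / 10) + Q))
      (HEN : ∀ r ∈ Icc s (s + w), ∫⁻ z, ENNReal.ofReal (((N : ℝ) + 1)⁻¹ * ∑ i : Fin (N + 1),
          Set.indicator {v : V3 | M₃ < ‖v‖} (fun v => ‖v‖ ^ (3 : ℕ)) ((Φ.flow r z i).2)) ∂(localGibbsLaw σ a₀ u₀ θ₀ N Φ) ≤ ENNReal.ofReal 1)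
      (hStrI : Integrable (fun z => (∫ r' in s..(s + w), ∑ i : Fin (N + 1),
          (Torus.timeDerivWithin (Ico 0 T) (fun t'' x =>
              Real.log (ρ t'' x * Rf (σ ^ (3 : ℕ) * ρ t'' x)) - 3 / 2 * Real.log (2 * Real.pi * θ t'' x) -
                ‖(Φ.flow r' z i).2 - u t'' x‖ ^ (2 : ℕ) / (2 * θ t'' x)) r' (Φ.flow r' z i).1 +
            ∑ k : Fin 3, (Φ.flow r' z i).2 k * Torus.partialDeriv k (fun x =>
              Real.log (ρ r' x * Rf (σ ^ (3 : ℕ) * ρ r' x)) - 3 / 2 * Real.log (2 * Real.pi * θ r' x) -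
                ‖(Φ.flow r' z i).2 - u r' x‖ ^ (2 : ℕ) / (2 * θ r' x)) (Φ.flow r' z i).1))) (localGibbsLaw σ a₀ u₀ θ₀ N Φ))
      (hColI : Integrable (fun z => (Φ.collisionSum (Ioc s (s + w)) (fun c =>
          ((∑ k : Fin 3, (u c.time c.fstPos k / θ c.time c.fstPos - u c.time c.sndPos k / θ c.time c.sndPos) *
              (c.postVel.1 k - c.preVel.1 k)) -
            ((θ c.time c.fstPos)⁻¹ - (θ c.time c.sndPos)⁻¹) * ((‖c.postVel.1‖ ^ (2 : ℕ) - ‖c.preVel.1‖ ^ (2 : ℕ)) / 2)) / 2) z)) (localGibbsLaw σ a₀ u₀ θ₀ N Φ)),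
      -(∫ z, ((∫ r' in s..(s + w), ∑ i : Fin (N + 1),
          (Torus.timeDerivWithin (Ico 0 T) (fun t'' x =>
              Real.log (ρ t'' x * Rf (σ ^ (3 : ℕ) * ρ t'' x)) - 3 / 2 * Real.log (2 * Real.pi * θ t'' x) -
                ‖(Φ.flow r' z i).2 - u t'' x‖ ^ (2 : ℕ) / (2 * θ t'' x)) r' (Φ.flow r' z i).1 +
            ∑ k : Fin 3, (Φ.flow r' z i).2 k * Torus.partialDeriv k (fun x =>
              Real.log (ρ r' x * Rf (σ ^ (3 : ℕ) * ρ r' x)) - 3 / 2 * Real.log (2 * Real.pi * θ r' x) -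
                ‖(Φ.flow r' z i).2 - u r' x‖ ^ (2 : ℕ) / (2 * θ r' x)) (Φ.flow r' z i).1)) +
        (Φ.collisionSum (Ioc s (s + w)) (fun c =>
          ((∑ k : Fin 3, (u c.time c.fstPos k / θ c.time c.fstPos - u c.time c.sndPos k / θ c.time c.sndPos) *
              (c.postVel.1 k - c.preVel.1 k)) -
            ((θ c.time c.fstPos)⁻¹ - (θ c.time c.sndPos)⁻¹) * ((‖c.postVel.1‖ ^ (2 : ℕ) - ‖c.preVel.1‖ ^ (2 : ℕ)) / 2)) / 2) z)) ∂(localGibbsLaw σ a₀ u₀ θ₀ N Φ)) ≤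
        5 / β * w * (klDiv (Φ.lawAt (localGibbsLaw σ a₀ u₀ θ₀ N Φ) s) (localGibbsLaw σ (fun x => ρ s x * Rf (σ ^ (3 : ℕ) * ρ s x)) (u s) (θ s) N Φ)).toReal + w * ((N : ℝ) + 1) * ε' + Q +
          w * ((N : ℝ) + 1) * (∫ x, ρ s x * (ρ s x * σ ^ (3 : ℕ)) * deriv hsCompressibility (ρ s x * σ ^ (3 : ℕ)) * Torus.divergence (u s) x) 

set_option maxHeartbeats 400000 in -- one declaration: six channel instantiations against explicit window functionals (as the sibling)
/-- **STUB `stub_windowEstimateRate : WindowEstimateRate` — THE PER-WINDOW ESTIMATE OF THE HEART WITH AN ADDITIVE CUBIC SLACK `Q`**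
(line `Sketch`, crux `ClampedTransferDock`; the rate twin of `ClampedCurrentsDockHeart.window_estimate`: identical hypotheses except that
the cubic channel of the window is bounded by `w(N+1)ε′/10 + Q`, `Q ≥ 0` arbitrary, and `Q` reappears additively in the conclusion; proof
verbatim otherwise — adapted from `Theorems/OneFlightGossipEngineClampedCurrentsDockHeartWindow.lean`).
[cite: Yau1991, §3; KipnisLandim1999, Ch. 6] -/
theorem stub_windowEstimateRate : WindowEstimateRate := by
  intro σ T η₁ τ t s w V L Cfz CG β ε' ε₁ ε₃ M₃ Q N Φ ρ θ u F Rf G a₀ θ₀ u₀ ha₀ hθ₀ hu₀ ha₀0 hθ₀0 hEul hσ hσ2 hη₁ hF hZF hRfF hpackF ha ha0 ht hs0 hw hsw hτ hw_def hV0 hL0 hCfz0 hLipm hLipe hGs hCG HFZ hβ hε hε1 hε₁ hε₃ hQ0 hsmall hKs hCm hCe hTs hQs HEN hStrI hColI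
  subst hw_def
  set P := localGibbsLaw σ a₀ u₀ θ₀ N Φ with hP_def
  have hgood : ∀ᵐ z ∂P, z ∈ Φ.good := ae_mem_good_localGibbsLaw σ a₀ u₀ θ₀ N Φ
  haveI : IsProbabilityMeasure P := isProbabilityMeasure_localGibbsLaw ha₀ hθ₀ hu₀ ha₀0 hθ₀0 hσ2.le N Φ
  have hsw' : s ≤ s + (τ * ((N : ℝ) + 1) ^ (-(1 / 3 : ℝ))) := le_add_of_nonneg_right hw.le
  have hsT : s ∈ Set.Ico 0 T := ⟨hs0, (hsw'.trans hsw).trans_lt ht.2⟩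
  have hIcc_t : Set.Icc s (s + (τ * ((N : ℝ) + 1) ^ (-(1 / 3 : ℝ)))) ⊆ Set.Icc 0 t := fun r hr => ⟨hs0.trans hr.1, hr.2.trans hsw⟩
  have hM0 : 0 ≤ max M₃ 0 := le_max_right _ _
  -- slices at the window start
  have hθs : Torus.IsSmooth (θ s) := hEul.smooth_temperature.isSmooth_slice hsT
  have hus : Torus.IsSmooth (u s) := hEul.smooth_velocity.isSmooth_slice hsT
  have hρsc : Continuous (ρ s) := (hEul.smooth_density.isSmooth_slice hsT).continuous
  have hθsc : Continuous (θ s) := hθs.continuous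
  have husc : Continuous (u s) := hus.continuous
  have hθs0 : ∀ x, 0 < θ s x := hEul.temperature_pos s hsT
  have has_c : Continuous fun x => ρ s x * Rf (σ ^ 3 * ρ s x) := (ha.isSmooth_slice hsT).continuous
  have has_0 : ∀ x, 0 < ρ s x * Rf (σ ^ 3 * ρ s x) := ha0 s hsT
  obtain ⟨hZst, hZ'st⟩ := ClampedCurrentsDockFreezeToolkit.sst_hsCompressibility_comp (S := Set.Ico 0 T) hF hZF
    hEul.smooth_density hpackF
  have hZc : Continuous fun x => hsCompressibility (ρ s x * σ ^ 3) := (hZst.isSmooth_slice hsT).continuous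
  have hZ'c : Continuous fun x => deriv hsCompressibility (ρ s x * σ ^ 3) := (hZ'st.isSmooth_slice hsT).continuous
  -- quadratic growth of the frozen integrands
  obtain ⟨Clo, hloc, hloC⟩ := exists_growth_lo (Gs := G s) (CG := CG) hθs hus hθs0 hGs hCG
  choose CF hFkc hFkC using fun k : Fin 3 => exists_growth_rowk (ρ₀ := ρ s)
    (Zf := fun x => hsCompressibility (ρ s x * σ ^ 3)) (Z'f := fun x => deriv hsCompressibility (ρ s x * σ ^ 3)) σ k
    hθs hus hθs0 hρsc hZc hZ'c
  obtain ⟨CE, hFec, hFeC⟩ := exists_growth_rowe (ρ₀ := ρ s)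
    (Zf := fun x => hsCompressibility (ρ s x * σ ^ 3)) (Z'f := fun x => deriv hsCompressibility (ρ s x * σ ^ 3)) σ
    hθs hus hθs0 hρsc hZc hZ'c
  -- measurable versions and bounds of the clamped functionals (MZ, landed)
  obtain ⟨hMA, -, hMY, ⟨Ye, hYem, hYe⟩, hMbm, hMbe⟩ :=
    ClampedCurrentsDockClampedMeasurable.stub_clampedFunctionalsMeasurable σ N Φ (θ s) (u s) V τ L hσ hσ2 hτ hθsc husc
      hθs0 hL0 hLipm hLipe
  choose A hAm hA using hMA
  choose Ym hYmm hYm using hMY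
  obtain ⟨hFS, -⟩ := ClampedCurrentsDockFlowShiftFreeze.stub_flowShiftFreeze
  -- the functionals of the ledger
  set loF : T3 × V3 → ℝ := fun y =>
    (θ s y.1)⁻¹ * ∑ j : Fin 3, ∑ k : Fin 3,
        ((y.2 - u s y.1) j * (y.2 - u s y.1) k - (if j = k then ‖y.2 - u s y.1‖ ^ 2 / 3 else 0)) *
          Torus.partialDeriv k (fun x => u s x j) y.1 +
      (∑ k : Fin 3, Torus.partialDeriv k (θ s) y.1 / (2 * (θ s y.1) ^ 2) * (y.2 - u s y.1) k) *
        G s (y.1, ‖y.2 - u s y.1‖ ^ 2) with hloF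
  set hiF : T3 × V3 → ℝ := fun y =>
    (∑ k : Fin 3, Torus.partialDeriv k (θ s) y.1 / (2 * (θ s y.1) ^ 2) * (y.2 - u s y.1) k) *
      (‖y.2 - u s y.1‖ ^ 2 - 5 * θ s y.1 - G s (y.1, ‖y.2 - u s y.1‖ ^ 2)) with hhiF
  set Fk : Fin 3 → T3 × V3 → ℝ := fun k y => Torus.partialDeriv k (fun x => u s x k / θ s x) y.1 *
    (θ s y.1 * (ρ s y.1 * σ ^ 3) * deriv hsCompressibility (ρ s y.1 * σ ^ 3) +
      (1 / 3) * (hsCompressibility (ρ s y.1 * σ ^ 3) - 1) * ‖y.2 - u s y.1‖ ^ 2) with hFk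
  set ck : Fin 3 → ℝ := fun k => (τ * ((N : ℝ) + 1) ^ (-(1 / 3 : ℝ))) * ((N : ℝ) + 1) * ∫ x, ρ s x * Torus.partialDeriv k (fun x => u s x k / θ s x) x *
    (θ s x * (ρ s x * σ ^ 3) * deriv hsCompressibility (ρ s x * σ ^ 3)) with hck
  set Xk : Fin 3 → Config (N + 1) (Fin 3) T3 → ℝ := fun k z => Φ.collisionSum (Set.Ioc 0 (τ * ((N : ℝ) + 1) ^ (-(1 / 3 : ℝ))))
    (fun c => (if σ / τ * Φ.collisionSum (Set.Ioc 0 (τ * ((N : ℝ) + 1) ^ (-(1 / 3 : ℝ)))) (fun c' => if c'.fst = c.fst then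
          ‖c'.postVel.1 - c'.preVel.1‖ + |‖c'.postVel.1‖ ^ 2 - ‖c'.preVel.1‖ ^ 2| / 2 else 0) z ≤ V then (1 : ℝ) else 0) *
      (if σ / τ * Φ.collisionSum (Set.Ioc 0 (τ * ((N : ℝ) + 1) ^ (-(1 / 3 : ℝ)))) (fun c' => if c'.fst = c.snd then
          ‖c'.postVel.1 - c'.preVel.1‖ + |‖c'.postVel.1‖ ^ 2 - ‖c'.preVel.1‖ ^ 2| / 2 else 0) z ≤ V then (1 : ℝ) else 0) *
      ((u s c.fstPos k / θ s c.fstPos - u s c.sndPos k / θ s c.sndPos) * (c.postVel.1 k - c.preVel.1 k)) / 2) z with hXk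
  set Fe : T3 × V3 → ℝ := fun y =>
    (∑ l : Fin 3, u s y.1 l * Torus.partialDeriv l (fun x => -(θ s x)⁻¹) y.1) *
        (θ s y.1 * (ρ s y.1 * σ ^ 3) * deriv hsCompressibility (ρ s y.1 * σ ^ 3) +
          (1 / 3) * (hsCompressibility (ρ s y.1 * σ ^ 3) - 1) * ‖y.2 - u s y.1‖ ^ 2) +
      θ s y.1 * (hsCompressibility (ρ s y.1 * σ ^ 3) - 1) *
        (∑ l : Fin 3, Torus.partialDeriv l (fun x => -(θ s x)⁻¹) y.1 * (y.2 - u s y.1) l) with hFe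
  set ce : ℝ := (τ * ((N : ℝ) + 1) ^ (-(1 / 3 : ℝ))) * ((N : ℝ) + 1) * ∫ x, ρ s x * (∑ l : Fin 3, u s x l * Torus.partialDeriv l (fun x => -(θ s x)⁻¹) x) *
    (θ s x * (ρ s x * σ ^ 3) * deriv hsCompressibility (ρ s x * σ ^ 3)) with hce
  set Xe : Config (N + 1) (Fin 3) T3 → ℝ := fun z => Φ.collisionSum (Set.Ioc 0 (τ * ((N : ℝ) + 1) ^ (-(1 / 3 : ℝ))))
    (fun c => (if σ / τ * Φ.collisionSum (Set.Ioc 0 (τ * ((N : ℝ) + 1) ^ (-(1 / 3 : ℝ)))) (fun c' => if c'.fst = c.fst then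
          ‖c'.postVel.1 - c'.preVel.1‖ + |‖c'.postVel.1‖ ^ 2 - ‖c'.preVel.1‖ ^ 2| / 2 else 0) z ≤ V then (1 : ℝ) else 0) *
      (if σ / τ * Φ.collisionSum (Set.Ioc 0 (τ * ((N : ℝ) + 1) ^ (-(1 / 3 : ℝ)))) (fun c' => if c'.fst = c.snd then
          ‖c'.postVel.1 - c'.preVel.1‖ + |‖c'.postVel.1‖ ^ 2 - ‖c'.preVel.1‖ ^ 2| / 2 else 0) z ≤ V then (1 : ℝ) else 0) *
      ((-(θ s c.fstPos)⁻¹ - -(θ s c.sndPos)⁻¹) * ((‖c.postVel.1‖ ^ 2 - ‖c.preVel.1‖ ^ 2) / 2)) / 2) z with hXe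
  set Jk : Fin 3 → Config (N + 1) (Fin 3) T3 → ℝ := fun k z =>
    ((∫ r' in s..(s + (τ * ((N : ℝ) + 1) ^ (-(1 / 3 : ℝ)))), ∑ i, Fk k (Φ.flow r' z i)) - ck k) - Xk k (Φ.flow s z) with hJk
  set Je : Config (N + 1) (Fin 3) T3 → ℝ := fun z =>
    ((∫ r' in s..(s + (τ * ((N : ℝ) + 1) ^ (-(1 / 3 : ℝ)))), ∑ i, Fe (Φ.flow r' z i)) - ce) - Xe (Φ.flow s z) with hJe
  set actT : Fin (N + 1) → Config (N + 1) (Fin 3) T3 → ℝ := fun i z => σ / τ * Φ.collisionSum (Set.Ioc s (s + (τ * ((N : ℝ) + 1) ^ (-(1 / 3 : ℝ)))))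
    (fun c => if c.fst = i then ‖c.postVel.1 - c.preVel.1‖ + |‖c.postVel.1‖ ^ 2 - ‖c.preVel.1‖ ^ 2| / 2 else 0) z
    with hactT
  set tail : Config (N + 1) (Fin 3) T3 → ℝ := fun z => ∑ i, Set.indicator {y : ℝ | V < y} (fun y => y) (actT i z) with htail
  set cub : Config (N + 1) (Fin 3) T3 → ℝ := fun z => ∫ r' in s..(s + (τ * ((N : ℝ) + 1) ^ (-(1 / 3 : ℝ)))), ∑ i, ‖(Φ.flow r' z i).2‖ ^ 3 with hcub
  set hiT : Config (N + 1) (Fin 3) T3 → ℝ := fun z => |∫ r' in s..(s + (τ * ((N : ℝ) + 1) ^ (-(1 / 3 : ℝ)))), ∑ i, hiF (Φ.flow r' z i)| with hhiT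
  set kin : Config (N + 1) (Fin 3) T3 → ℝ := fun z => -(∫ r' in s..(s + (τ * ((N : ℝ) + 1) ^ (-(1 / 3 : ℝ)))), ∑ i, loF (Φ.flow r' z i)) with hkin
  set Hs : ℝ := (klDiv (Φ.lawAt P s) (localGibbsLaw σ (fun x => ρ s x * Rf (σ ^ 3 * ρ s x)) (u s) (θ s) N Φ)).toReal with hHs
  -- ===== the channels in expectation =====
  have hkinI : Integrable kin P ∧ ∫ z, kin z ∂P ≤ (τ * ((N : ℝ) + 1) ^ (-(1 / 3 : ℝ))) * (β⁻¹ * (Hs + ε₁ * ((N : ℝ) + 1))) :=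
    kinetic_expectation Φ (a₀ := a₀) (θ₀ := θ₀) (u₀ := u₀) (b := fun x => ρ s x * Rf (σ ^ 3 * ρ s x)) (ϑ := θ s)
      (wv := u s) (lo := loF) (C := Clo) (γ := β) (B := ε₁ * ((N : ℝ) + 1)) (s := s) (w := (τ * ((N : ℝ) + 1) ^ (-(1 / 3 : ℝ)))) hσ hσ2 ha₀ hθ₀ hu₀ ha₀0 hθ₀0
      has_c hθsc husc has_0 hθs0 hloc hloC hs0 hw hβ hKs
  have hJkI : ∀ k, Integrable (Jk k) P ∧ ∫ z, Jk k z ∂P ≤ (τ * ((N : ℝ) + 1) ^ (-(1 / 3 : ℝ))) * (β⁻¹ * (Hs + ε₁ / 4 * ((N : ℝ) + 1))) := fun k =>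
    row_expectation Φ (a₀ := a₀) (θ₀ := θ₀) (u₀ := u₀) (b := fun x => ρ s x * Rf (σ ^ 3 * ρ s x)) (ϑ := θ s) (wv := u s)
      (F := Fk k) (X := Xk k) (C := CF k) (Mx := L * (τ * ((N : ℝ) + 1) ^ (-(1 / 3 : ℝ))) * ((N : ℝ) + 1) * max V 0) (γ := β)
      (B := ε₁ / 4 * ((N : ℝ) + 1)) (s := s) (w := (τ * ((N : ℝ) + 1) ^ (-(1 / 3 : ℝ)))) (c := ck k) hσ hσ2 ha₀ hθ₀ hu₀ ha₀0 hθ₀0 has_c hθsc husc has_0 hθs0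
      (hFkc k) (hFkC k) ⟨Ym k, hYmm k, hYm k⟩ (fun z hz => hMbm z hz k) hs0 hw hβ (hCm k)
  have hJeI : Integrable Je P ∧ ∫ z, Je z ∂P ≤ (τ * ((N : ℝ) + 1) ^ (-(1 / 3 : ℝ))) * (β⁻¹ * (Hs + ε₁ / 4 * ((N : ℝ) + 1))) :=
    row_expectation Φ (a₀ := a₀) (θ₀ := θ₀) (u₀ := u₀) (b := fun x => ρ s x * Rf (σ ^ 3 * ρ s x)) (ϑ := θ s) (wv := u s)
      (F := Fe) (X := Xe) (C := CE) (Mx := L * (τ * ((N : ℝ) + 1) ^ (-(1 / 3 : ℝ))) * ((N : ℝ) + 1) * max V 0) (γ := β)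
      (B := ε₁ / 4 * ((N : ℝ) + 1)) (s := s) (w := (τ * ((N : ℝ) + 1) ^ (-(1 / 3 : ℝ)))) (c := ce) hσ hσ2 ha₀ hθ₀ hu₀ ha₀0 hθ₀0 has_c hθsc husc has_0 hθs0
      hFec hFeC ⟨Ye, hYem, hYe⟩ hMbe hs0 hw hβ hCe
  have hJsumI : Integrable (fun z => (∑ k, Jk k z) + Je z) P := (integrable_finsetSum _ fun k _ => (hJkI k).1).add hJeI.1
  have hJsum : Integrable (fun z => (∑ k, Jk k z) + Je z) P ∧
      ∫ z, ((∑ k, Jk k z) + Je z) ∂P ≤ 4 * ((τ * ((N : ℝ) + 1) ^ (-(1 / 3 : ℝ))) * (β⁻¹ * (Hs + ε₁ / 4 * ((N : ℝ) + 1)))) := by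
    refine ⟨hJsumI, ?_⟩
    rw [integral_add (integrable_finsetSum _ fun k _ => (hJkI k).1) hJeI.1, integral_finsetSum _ fun k _ => (hJkI k).1]
    have h3 : ∑ k : Fin 3, ∫ z, Jk k z ∂P ≤ ∑ _k : Fin 3, (τ * ((N : ℝ) + 1) ^ (-(1 / 3 : ℝ))) * (β⁻¹ * (Hs + ε₁ / 4 * ((N : ℝ) + 1))) :=
      Finset.sum_le_sum fun k _ => (hJkI k).2
    rw [Finset.sum_const, Finset.card_univ, Fintype.card_fin] at h3
    simp only [nsmul_eq_mul, Nat.cast_ofNat] at h3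
    linarith [hJeI.2]
  have hhic : Continuous hiF := by
    have hθne : ∀ y : T3 × V3, θ s y.1 ≠ 0 := fun y => (hθs0 _).ne'
    have hDθc : ∀ k, Continuous (Torus.partialDeriv k (θ s)) := fun k => (hθs.partialDeriv k).continuous
    simp only [hhiF]
    fun_prop (disch := (intro y; exact mul_ne_zero two_ne_zero (pow_ne_zero _ (hθne y))))
  have hhiTI : Integrable hiT P ∧ ∫ z, hiT z ∂P ≤ (τ * ((N : ℝ) + 1) ^ (-(1 / 3 : ℝ))) * ((N : ℝ) + 1) * (ε' / 10) + Q := by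
    refine integral_le_of_good_version Φ a₀ θ₀ u₀ ?_ (fun z _ => abs_nonneg _) (by positivity) hQs
    refine exists_measurable_eqOn_good Φ ?_
    have hm := measurable_sum_windowIntegral Φ hhic s (s + (τ * ((N : ℝ) + 1) ^ (-(1 / 3 : ℝ))))
    have heq : (fun z : Φ.good => hiT z) = fun z : Φ.good =>
        |∑ i, ∫ r' in s..(s + (τ * ((N : ℝ) + 1) ^ (-(1 / 3 : ℝ)))), hiF (Φ.flow r' (z : Config (N + 1) (Fin 3) T3) i)| := by
      funext z; simp only [hhiT, integral_sum_orbit Φ z.2 hhic]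
    rw [heq]
    exact continuous_abs.measurable.comp hm
  have hcubI : Integrable cub P ∧ ∫ z, cub z ∂P ≤ (τ * ((N : ℝ) + 1) ^ (-(1 / 3 : ℝ))) * ((N : ℝ) + 1) * ((max M₃ 0) ^ 3 + 1) := by
    refine integral_le_of_good_version Φ a₀ θ₀ u₀ ?_ ?_ (by positivity) ?_
    · refine exists_measurable_eqOn_good Φ ?_
      have hm := measurable_sum_windowIntegral Φ (F := fun y : T3 × V3 => ‖y.2‖ ^ 3) (by fun_prop) s (s + (τ * ((N : ℝ) + 1) ^ (-(1 / 3 : ℝ))))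
      have heq : (fun z : Φ.good => cub z) = fun z : Φ.good =>
          ∑ i, ∫ r' in s..(s + (τ * ((N : ℝ) + 1) ^ (-(1 / 3 : ℝ)))), ‖(Φ.flow r' (z : Config (N + 1) (Fin 3) T3) i).2‖ ^ 3 := by
        funext z
        exact integral_sum_orbit Φ z.2 (F := fun y : T3 × V3 => ‖y.2‖ ^ 3) (by fun_prop) s (s + (τ * ((N : ℝ) + 1) ^ (-(1 / 3 : ℝ))))
      rw [heq]; exact hm
    · intro z _
      exact intervalIntegral.integral_nonneg hsw' fun r _ => Finset.sum_nonneg fun i _ => by positivity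
    · refine ClampedCurrentsDockThirdMoment.stub_thirdMomentWindow σ N Φ a₀ θ₀ u₀ (max M₃ 0) s (τ * ((N : ℝ) + 1) ^ (-(1 / 3 : ℝ))) hσ hσ2 ha₀ hθ₀ hu₀
        ha₀0 hθ₀0 hM0 hs0 hw.le fun r hr => ?_
      refine le_trans (lintegral_mono fun z => ENNReal.ofReal_le_ofReal ?_) (HEN r hr)
      refine mul_le_mul_of_nonneg_left (Finset.sum_le_sum fun i _ => ?_) (by positivity)
      exact indicator_cube_anti (le_max_left M₃ 0) _
  have htailI : Integrable tail P ∧ ∫ z, tail z ∂P ≤ ((N : ℝ) + 1) * ε₃ := by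
    refine integral_le_of_good_version Φ a₀ θ₀ u₀ ?_ ?_ (by rw [hε₃]; positivity) (lintegral_le_of_normalised hTs)
    · refine ⟨fun z => ∑ i, Set.indicator {y : ℝ | V < y} (fun y => y) (A i (Φ.flow s z)), ?_, ?_⟩
      · exact Finset.measurable_sum _ fun i _ =>
          (measurable_id.indicator measurableSet_Ioi).comp ((hAm i).comp (Φ.measurable_flow s))
      · intro z hz
        simp only [htail]
        refine Finset.sum_congr rfl fun i _ => ?_
        rw [hA i (Φ.mapsTo_good s hz)]
        simp only [hactT]
        rw [← (hFS σ N Φ s (τ * ((N : ℝ) + 1) ^ (-(1 / 3 : ℝ))) hs0 hw.le z hz).2]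
    · intro z _
      exact Finset.sum_nonneg fun i _ => indicator_tail_nonneg hV0
  -- ===== the domination on the good set and the bookkeeping =====
  have hX := hStrI.add hColI
  have hdom : ∀ z ∈ Φ.good, -((∫ r' in s..(s + (τ * ((N : ℝ) + 1) ^ (-(1 / 3 : ℝ)))), ∑ i : Fin (N + 1),
        (Torus.timeDerivWithin (Ico 0 T) (fun t'' x =>
            Real.log (ρ t'' x * Rf (σ ^ 3 * ρ t'' x)) - 3 / 2 * Real.log (2 * Real.pi * θ t'' x) -
              ‖(Φ.flow r' z i).2 - u t'' x‖ ^ 2 / (2 * θ t'' x)) r' (Φ.flow r' z i).1 +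
          ∑ k : Fin 3, (Φ.flow r' z i).2 k * Torus.partialDeriv k (fun x =>
            Real.log (ρ r' x * Rf (σ ^ 3 * ρ r' x)) - 3 / 2 * Real.log (2 * Real.pi * θ r' x) -
              ‖(Φ.flow r' z i).2 - u r' x‖ ^ 2 / (2 * θ r' x)) (Φ.flow r' z i).1)) +
      (Φ.collisionSum (Ioc s (s + (τ * ((N : ℝ) + 1) ^ (-(1 / 3 : ℝ))))) (fun c =>
        ((∑ k : Fin 3, (u c.time c.fstPos k / θ c.time c.fstPos - u c.time c.sndPos k / θ c.time c.sndPos) *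
            (c.postVel.1 k - c.preVel.1 k)) -
          ((θ c.time c.fstPos)⁻¹ - (θ c.time c.sndPos)⁻¹) * ((‖c.postVel.1‖ ^ 2 - ‖c.preVel.1‖ ^ 2) / 2)) / 2) z)) ≤
      kin z + hiT z + (fun z => (∑ k, Jk k z) + Je z) z + (2 * L * (τ * ((N : ℝ) + 1) ^ (-(1 / 3 : ℝ))) + 2 * Cfz * (τ * ((N : ℝ) + 1) ^ (-(1 / 3 : ℝ))) ^ 2) * tail z +
        (2 * Cfz * (τ * ((N : ℝ) + 1) ^ (-(1 / 3 : ℝ)))) * cub z + ((τ * ((N : ℝ) + 1) ^ (-(1 / 3 : ℝ))) * ((N : ℝ) + 1) * (∫ x, ρ s x * (ρ s x * σ ^ 3) * deriv hsCompressibility (ρ s x * σ ^ 3) * Torus.divergence (u s) x) + 3 * Cfz * (τ * ((N : ℝ) + 1) ^ (-(1 / 3 : ℝ))) ^ 2 * ((N : ℝ) + 1) +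
          2 * Cfz * (τ * ((N : ℝ) + 1) ^ (-(1 / 3 : ℝ))) ^ 2 * (((N : ℝ) + 1) * V)) := fun z hz =>
    window_domination Φ hEul hσ hσ2 hη₁ hF hZF hRfF hpackF ha ha0 ht hs0 hw hsw hτ rfl hV0 hL0 hCfz0 hLipm hLipe hGs HFZ hz
  exact window_bookkeeping_rate hgood (Hs := Hs) (Nr := (N : ℝ) + 1) (M := max M₃ 0) hw hβ hε hε1 hL0 hCfz0 hM0 hV0 (by positivity)
    hε₁ hε₃ hsmall hX hdom hkinI hhiTI hJsum htailI hcubI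

end Summit.AtomisticToContinuum.HydrodynamicLimit.Theorems.ClampedTransferDockRate

end
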